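import Summits.QuantumAdvantage.QuantumAdvantage.Theorems.LinnikCubicClassGroupsDegreeOnePrimesEscapeChebotarevDivisionSplittingType
import Literature.NumberTheory.LFunctions.StarkNoQuadraticSubfieldGlue
import HarnessLib

/-!
# Every unramified splitting type of a number field recurs below `|d_K|^{L(n)}`

Topic `Summits/QuantumAdvantage/QuantumAdvantage/Theorems`, cell B2b-1 (linnik-cubic), PART A (gen 9);
helper toward the crux `DegreeOnePrimesEscape` (stmt-QuantumAdvantage-11543) of route
`LinnikCubicClassGroups`.  HONEST FRAMING: the value of this file is a THEOREM (kernel-checked, GRH-free,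
Siegel-free, no hypothesis) — NOT summit progress.

`exists_prime_splittingType_eq_le` — **the least prime with a given splitting type**, self-contained form:
for `n > 1` there is `L = L(n) > 0` such that for every number field `K` of degree `n` and every prime
`p₀ ∤ d_K`, there is a prime `p ≤ |d_K|^L`, `p ∤ d_K`, with the SAME splitting type as `p₀`:
`splittingType K p = splittingType K p₀`.  (Galois closure `N` of `K`, `exists_galoisClosure`; `p₀` is
unramified in `N` since `|d_N| ∣ ∏_f |d_{f(K)}|^{[N:f(K)]}`; its Frobenius `σ`; the prime `p` with the
splitting type of `σ` from `exists_prime_splittingType_le_of_embedding`; splitting types are determined by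
the sums `Σ_{f ∈ T, f ∣ j} f`, `eq_of_forall_sum_filter_dvd_eq`.)  This is Lagarias–Montgomery–Odlyzko's
theorem [LagariasMontgomeryOdlyzko1979, Thm. 1.1] in the form "least prime with a given splitting type",
unconditional, with an inexplicit degree-dependent exponent.

References: J. C. Lagarias, H. L. Montgomery, A. M. Odlyzko, Invent. Math. 54 (1979), Thm. 1.1
[LagariasMontgomeryOdlyzko1979]; R. Perlis, J. Number Theory 9 (1977) [Perlis1977].
-/

noncomputable section

open scoped NumberField nonZeroDivisors
open Finset Real Ideal NumberField
open Literature.NumberTheory.NumberFields Literature.NumberTheory.LFunctions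
  Literature.NumberTheory.LFunctions.NumberField

namespace Summit.QuantumAdvantage.QuantumAdvantage.Theorems.DegreeOnePrimesEscape

/-- **A prime unramified in `K` is unramified in the Galois closure**: if the embedded copies of `K`
separate `Gal(N/ℚ)` then `p ∣ d_N ⟹ p ∣ d_K` (`|d_N| ∣ ∏_f |d_{f(K)}|^{[N:f(K)]}`). -/
theorem dvd_discr_of_dvd_discr_closure {K N : Type} [Field K] [NumberField K] [Field N] [NumberField N]
    [IsGalois ℚ N]
    (hsep : ∀ s : N ≃ₐ[ℚ] N, s ≠ 1 → ∃ f : K →ₐ[ℚ] N, s ∉ f.fieldRange.fixingSubgroup)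
    {p : ℕ} (hp : p.Prime) (hpN : (p : ℤ) ∣ NumberField.discr N) : (p : ℤ) ∣ NumberField.discr K := by
  classical
  have hdvd := natAbs_discr_dvd_prod_pow_of_isGalois N Finset.univ (fun f : K →ₐ[ℚ] N => f.fieldRange)
    (fun s hs => by obtain ⟨f, hf⟩ := hsep s hs; exact ⟨f, Finset.mem_univ _, hf⟩)
  rw [Finset.prod_congr rfl fun f _ => by rw [natAbs_discr_fieldRange K N f],
    Finset.prod_pow_eq_pow_sum] at hdvd
  have h1 : p ∣ (NumberField.discr N).natAbs := Int.natCast_dvd.mp hpN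
  have h2 : p ∣ (NumberField.discr K).natAbs := hp.dvd_of_dvd_pow (h1.trans hdvd)
  exact Int.natCast_dvd.mpr h2

/-- **Every unramified splitting type recurs below `|d_K|^{L(n)}`** (the least prime with a given
splitting type; see the module docstring).  Unconditional. [cite: LagariasMontgomeryOdlyzko1979, Theorem 1.1] -/
theorem exists_prime_splittingType_eq_le (n : ℕ) (hn : 1 < n) :
    ∃ L : ℝ, 0 < L ∧ ∀ (K : Type) [Field K] [NumberField K], Module.finrank ℚ K = n →
      ∀ p₀ : ℕ, p₀.Prime → ¬ ((p₀ : ℤ) ∣ NumberField.discr K) →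
        ∃ p : ℕ, p.Prime ∧ (p : ℝ) ≤ ((NumberField.discr K).natAbs : ℝ) ^ L ∧
          ¬ ((p : ℤ) ∣ NumberField.discr K) ∧ splittingType K p = splittingType K p₀ := by
  classical
  obtain ⟨L, hL, h⟩ := exists_prime_splittingType_le_of_embedding n hn
  refine ⟨L, hL, fun K _ _ hK p₀ hp₀ hp₀K => ?_⟩
  obtain ⟨N, _, _, hGal, hNle, hKN, ⟨f₀⟩, hsep, hdN⟩ := exists_galoisClosure K
  haveI := hGal
  rw [hK] at hNle
  -- `p₀` is unramified in `N`; its Frobenius `σ`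
  have hp₀N : ¬ ((p₀ : ℤ) ∣ NumberField.discr N) := fun hd =>
    hp₀K (dvd_discr_of_dvd_discr_closure hsep hp₀ hd)
  obtain ⟨Q₀, hQ₀max, hQ₀over, ⟨σ, hσ⟩, hI₀⟩ := exists_isArithFrobAt_of_not_dvd_discr (N := N) hp₀ hp₀N
  -- the prime `p` with the splitting type of `σ` in `K`
  obtain ⟨p, hp, hpx, hpK, hcount⟩ := h K hK N f₀ hNle hdN σ
  refine ⟨p, hp, hpx, hpK, ?_⟩
  -- both splitting types have the same sums `Σ_{f ∣ j} f`, hence coincide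
  have hH0 : 0 < Nat.card f₀.fieldRange.fixingSubgroup := Nat.card_pos
  have hsums : ∀ j : ℕ, ((splittingType K p).filter (· ∣ j)).sum = ((splittingType K p₀).filter (· ∣ j)).sum := by
    intro j
    have h1 := hcount j
    have h2 := card_fixingSubgroup_mul_sum_filter_dvd f₀.fieldRange hp₀ Q₀ hσ hI₀ j
    rw [← ArithmeticallyEquivalent.of_algEquiv f₀.equivFieldRange p₀ hp₀] at h2
    exact Nat.eq_of_mul_eq_mul_left hH0 (h1.trans h2.symm)
  exact eq_of_forall_sum_filter_dvd_eq _ _ _ rfl (fun f hf => splittingType_pos hp hf)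
    (fun f hf => splittingType_pos hp₀ hf) hsums

end Summit.QuantumAdvantage.QuantumAdvantage.Theorems.DegreeOnePrimesEscape

end
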